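import Mathlib.RepresentationTheory.Irreducible
import Mathlib.RingTheory.SimpleModule.Isotypic
import Mathlib.RingTheory.Artinian.Module

/-!
# An irreducible representation of a product `G₁ × G₂` is `G₁`-isotypic

Kernel witness (cell pub-hodge-repro2, seat p5, Tier 5) for the structural half of the sentence
of route/T5-N4-p5.md v12 (A3) STEP 6 (l. 147)

> «An irreducible finite-dimensional representation ρ of K = K_∞ × K_f^{max} is ρ_∞ ⊗ ρ_f»,

in Mathlib's representation-theory vocabulary (`Representation`, `Subrepresentation`,
`IntertwiningMap`, `Representation.IsIrreducible`, `isotypicComponent`, `IsIsotypicOfType`).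

Let `ρ` be an irreducible representation of `G₁ × G₂` on a `k`-space `V` and let `ρ₁ := ρ ∘ inl`
be its restriction to `G₁`.  Every `ρ(1, g₂)` commutes with `ρ₁`, i.e. is an endomorphism of the
`k[G₁]`-module `V`; the `S`-isotypic component of `V` (for any simple `k[G₁]`-submodule `S`) is
mapped into itself by every `k[G₁]`-endomorphism (Mathlib: `LinearMap.le_comap_isotypicComponent`),
hence is a non-zero subrepresentation of `ρ`, hence is all of `V`:

* `isotypicComponent_eq_top` — `isotypicComponent k[G₁] V S = ⊤`;
* `isIsotypicOfType` / `isIsotypic` — `V` is `S`-isotypic as a `k[G₁]`-module (every simple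
  `k[G₁]`-submodule of `V` is isomorphic to `S`); in particular `V|_{G₁}` is semisimple;
* `exists_linearEquiv_fun` — for finite-dimensional `V`, `V ≃ₗ[k[G₁]] (Fin n → S)` for some `n`
  (Mathlib's `IsIsotypicOfType.linearEquiv_fun`): `ρ₁ ≅ S^{⊕ n}`, the multiplicity space being the
  `G₂`-representation `Hom_{G₁}(S, V)`;
* `exists_isSimpleModule` — a non-zero finite-dimensional `V` has a simple `k[G₁]`-submodule
  (Artinian ⇒ atomic), so the hypothesis `S` of the statements above is always available.

What is NOT proved here: the second half of the sentence — that the `G₂`-action on `ι → S`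
is `1 ⊗ ρ_f` for an irreducible `ρ_f` (Schur's lemma `End_{k[G₁]}(S) = k` for algebraically
closed `k`, Mathlib `IsIrreducible.algebraMap_intertwiningMap_bijective_of_isAlgClosed`, applied
to the commutant `M_ι(End(S))`); the compactness of `K` and the unitarity used in (A3) stay prose.
Mathlib only; nothing about `U(W_A)`, `K_∞`, `K_f^{max}` or the printed theorems is asserted.
-/

open scoped MonoidAlgebra

namespace Summit.Ventures.HodgeRepro2.T5ProductIsotypic

variable {k G₁ G₂ V : Type*} [Field k] [Monoid G₁] [Monoid G₂] [AddCommGroup V] [Module k V]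

/-- The restriction of a representation of `G₁ × G₂` to the first factor, `g₁ ↦ ρ (g₁, 1)`. -/
abbrev restrictFst (ρ : Representation k (G₁ × G₂) V) : Representation k G₁ V :=
  ρ.comp (MonoidHom.inl G₁ G₂)

/-- `restrictFst ρ g₁ = ρ (g₁, 1)`. -/
theorem restrictFst_apply (ρ : Representation k (G₁ × G₂) V) (g₁ : G₁) :
    restrictFst ρ g₁ = ρ (g₁, 1) := rfl

/-- `ρ (1, g₂)` commutes with the restricted representation `restrictFst ρ`. -/
theorem comm_inl_inr (ρ : Representation k (G₁ × G₂) V) (g₁ : G₁) (g₂ : G₂) (v : V) :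
    ρ (1, g₂) (restrictFst ρ g₁ v) = restrictFst ρ g₁ (ρ (1, g₂) v) := by
  rw [restrictFst_apply, ← Module.End.mul_apply, ← map_mul, ← Module.End.mul_apply, ← map_mul,
    Prod.mk_mul_mk, Prod.mk_mul_mk, one_mul, mul_one, one_mul, mul_one]

/-- `ρ (1, g₂)` as an intertwining map of `restrictFst ρ` with itself. -/
def rightAction (ρ : Representation k (G₁ × G₂) V) (g₂ : G₂) :
    Representation.IntertwiningMap (restrictFst ρ) (restrictFst ρ) :=
  LinearMap.intertwiningMap_of_isIntertwiningMap (restrictFst ρ) (restrictFst ρ) (ρ (1, g₂))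
    (fun g₁ v => comm_inl_inr ρ g₁ g₂ v)

/-- `rightAction ρ g₂ v = ρ (1, g₂) v`. -/
theorem rightAction_apply (ρ : Representation k (G₁ × G₂) V) (g₂ : G₂) (v : V) :
    rightAction ρ g₂ v = ρ (1, g₂) v := rfl

/-- `ρ (1, g₂)` as a `k[G₁]`-linear endomorphism of the `k[G₁]`-module `(restrictFst ρ).asModule`. -/
noncomputable def rightActionₗ (ρ : Representation k (G₁ × G₂) V) (g₂ : G₂) :
    (restrictFst ρ).asModule →ₗ[k[G₁]] (restrictFst ρ).asModule :=
  Representation.IntertwiningMap.equivLinearMapAsModule _ _ (rightAction ρ g₂)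

/-- `rightActionₗ ρ g₂ v = ρ (1, g₂) v`. -/
theorem rightActionₗ_apply (ρ : Representation k (G₁ × G₂) V) (g₂ : G₂)
    (v : (restrictFst ρ).asModule) : rightActionₗ ρ g₂ v = ρ (1, g₂) v := rfl

/-- A `k[G₁]`-submodule `N` of `(restrictFst ρ).asModule` that is stable under every `ρ (1, g₂)`
is a subrepresentation of `ρ`. -/
def subrepresentationOfStable (ρ : Representation k (G₁ × G₂) V)
    (N : Submodule k[G₁] (restrictFst ρ).asModule)
    (hN : ∀ g₂ : G₂, ∀ v, v ∈ N → ρ (1, g₂) v ∈ N) : Subrepresentation ρ where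
  toSubmodule := (Subrepresentation.ofSubmodule' N).toSubmodule
  apply_mem_toSubmodule g v hv := by
    have h1 : ρ g v = restrictFst ρ g.1 (ρ (1, g.2) v) := by
      rw [restrictFst_apply, ← Module.End.mul_apply, ← map_mul, Prod.mk_mul_mk, one_mul, mul_one]
    rw [h1]
    exact (Subrepresentation.ofSubmodule' N).apply_mem_toSubmodule g.1 (hN g.2 v hv)

/-- Membership in `subrepresentationOfStable`. -/
theorem mem_subrepresentationOfStable (ρ : Representation k (G₁ × G₂) V)
    (N : Submodule k[G₁] (restrictFst ρ).asModule) (hN) (v : V) :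
    v ∈ subrepresentationOfStable ρ N hN ↔ v ∈ N := Iff.rfl

/-- The isotypic component of a simple `k[G₁]`-submodule `S` is stable under every `ρ (1, g₂)`. -/
theorem isotypicComponent_stable (ρ : Representation k (G₁ × G₂) V)
    (S : Submodule k[G₁] (restrictFst ρ).asModule) [IsSimpleModule k[G₁] S] (g₂ : G₂) (v)
    (hv : v ∈ isotypicComponent k[G₁] (restrictFst ρ).asModule S) :
    ρ (1, g₂) v ∈ isotypicComponent k[G₁] (restrictFst ρ).asModule S :=
  Submodule.mem_comap.mp (LinearMap.le_comap_isotypicComponent S (rightActionₗ ρ g₂) hv)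

/-- A subrepresentation of an irreducible representation is `⊥` or `⊤`. -/
theorem eq_bot_or_eq_top (ρ : Representation k (G₁ × G₂) V) [ρ.IsIrreducible]
    (σ : Subrepresentation ρ) : σ = ⊥ ∨ σ = ⊤ :=
  IsSimpleOrder.eq_bot_or_eq_top σ

/-- THE STRUCTURAL STEP: for an irreducible `ρ` of `G₁ × G₂` and a simple `k[G₁]`-submodule `S`
of `V`, the `S`-isotypic component of the `k[G₁]`-module `V` is all of `V`. -/
theorem isotypicComponent_eq_top (ρ : Representation k (G₁ × G₂) V) [ρ.IsIrreducible]
    (S : Submodule k[G₁] (restrictFst ρ).asModule) [IsSimpleModule k[G₁] S] :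
    isotypicComponent k[G₁] (restrictFst ρ).asModule S = ⊤ := by
  set N := isotypicComponent k[G₁] (restrictFst ρ).asModule S with hNdef
  let σ := subrepresentationOfStable ρ N (isotypicComponent_stable ρ S)
  rcases eq_bot_or_eq_top ρ σ with hσ | hσ
  · exfalso
    obtain ⟨x, hxN, hx0⟩ := (Submodule.ne_bot_iff N).mp (bot_lt_isotypicComponent S).ne'
    have hxσ : x ∈ σ := (mem_subrepresentationOfStable ρ N _ x).mpr hxN
    rw [hσ] at hxσ
    exact hx0 ((Submodule.mem_bot k).mp hxσ)
  · rw [eq_top_iff]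
    intro x _
    have hxσ : x ∈ σ := by rw [hσ]; trivial
    exact (mem_subrepresentationOfStable ρ N _ x).mp hxσ

/-- `V` is `S`-isotypic as a `k[G₁]`-module: every simple `k[G₁]`-submodule of `V` is isomorphic
to `S`. -/
theorem isIsotypicOfType (ρ : Representation k (G₁ × G₂) V) [ρ.IsIrreducible]
    (S : Submodule k[G₁] (restrictFst ρ).asModule) [IsSimpleModule k[G₁] S] :
    IsIsotypicOfType k[G₁] (restrictFst ρ).asModule S :=
  IsIsotypicOfType.of_isotypicComponent_eq_top (isotypicComponent_eq_top ρ S)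

/-- All simple `k[G₁]`-submodules of `V` are isomorphic. -/
theorem isIsotypic (ρ : Representation k (G₁ × G₂) V) [ρ.IsIrreducible] :
    IsIsotypic k[G₁] (restrictFst ρ).asModule :=
  fun S _ => isIsotypicOfType ρ S

/-- `V` is semisimple as a `k[G₁]`-module (a sum of simple submodules). -/
theorem isSemisimpleModule (ρ : Representation k (G₁ × G₂) V) [ρ.IsIrreducible]
    (S : Submodule k[G₁] (restrictFst ρ).asModule) [IsSimpleModule k[G₁] S] :
    IsSemisimpleModule k[G₁] (restrictFst ρ).asModule := by
  refine IsSemisimpleModule.of_sSup_simples_eq_top (eq_top_iff.mpr ?_)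
  rw [← isotypicComponent_eq_top ρ S, isotypicComponent]
  refine sSup_le_sSup fun m hm => ?_
  obtain ⟨e⟩ := hm
  exact IsSimpleModule.congr e

/-- For finite-dimensional `V`: `V ≃ₗ[k[G₁]] (Fin n → S)` for some `n` — `ρ₁ ≅ S^{⊕ n}`. -/
theorem exists_linearEquiv_fun [Module.Finite k V] (ρ : Representation k (G₁ × G₂) V)
    [ρ.IsIrreducible] (S : Submodule k[G₁] (restrictFst ρ).asModule) [IsSimpleModule k[G₁] S] :
    ∃ n : ℕ, Nonempty ((restrictFst ρ).asModule ≃ₗ[k[G₁]] (Fin n → S)) := by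
  haveI : Module.Finite k[G₁] (restrictFst ρ).asModule :=
    Module.Finite.of_restrictScalars_finite k k[G₁] (restrictFst ρ).asModule
  haveI := isSemisimpleModule ρ S
  exact (isIsotypicOfType ρ S).linearEquiv_fun

/-- A non-zero finite-dimensional `V` has a simple `k[G₁]`-submodule (the `k[G₁]`-module `V` is
Artinian, hence its submodule lattice is atomic). -/
theorem exists_isSimpleModule [Module.Finite k V] [Nontrivial V]
    (ρ : Representation k (G₁ × G₂) V) :
    ∃ S : Submodule k[G₁] (restrictFst ρ).asModule, IsSimpleModule k[G₁] S := by
  haveI : IsArtinian k (restrictFst ρ).asModule := inferInstance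
  haveI : IsArtinian k[G₁] (restrictFst ρ).asModule := isArtinian_of_tower k inferInstance
  haveI : IsAtomic (Submodule k[G₁] (restrictFst ρ).asModule) :=
    isAtomic_of_orderBot_wellFounded_lt wellFounded_lt
  haveI : Nontrivial (restrictFst ρ).asModule := ‹Nontrivial V›
  haveI : Nontrivial (Submodule k[G₁] (restrictFst ρ).asModule) :=
    (Submodule.nontrivial_iff k[G₁]).mpr inferInstance
  obtain ⟨S, hS⟩ := IsAtomic.exists_atom (α := Submodule k[G₁] (restrictFst ρ).asModule)
  exact ⟨S, isSimpleModule_iff_isAtom.mpr hS⟩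

end Summit.Ventures.HodgeRepro2.T5ProductIsotypic
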